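import Summits.CriticalPhenomena.CardyFormulaZ2.Theorems.CardyIKTransportIKLinearTransportSDECore3

/-!
# Stub `stub_StripDiagramExchange` — core part 4: the strip observables versus the cylinder block

Continues `…SDECore3`. The local isomorphism between the strip triangulation of `SDE.X` and the cylinder block read off
the window (`SDE.block_adj_iff_cell`), the strip diagram through `within`-reachability and its window approximations
`SDE.DgW` (monotone, exhausting), the transfer of monochromatic connections strip → cylinder and cylinder → strip inside
interior rows, and THE DICHOTOMY `SDE.strip_dichotomy`: a cylinder connection between window cells either is a window
connection of the strip or exhibits a strip path to an extreme row of the window.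
-/

set_option autoImplicit false

noncomputable section

namespace Summit.CriticalPhenomena.CardyFormulaZ2.Theorems.IKLinearTransport.PinnedDiagramExchange

open scoped Classical MeasureTheory ENNReal ProbabilityTheory BigOperators
open MeasureTheory Literature.Probability.Percolation Literature.Probability.LatticeModels

namespace SDE
/-! ## §10 The strip observables versus the cylinder block -/

/-- Cylinder cell ↦ strip cell. [folklore] -/
def ψ (i a : ℤ) {N : ℕ} (x : Fin 3 × ZMod N) : Site 2 := ![i + (x.1 : ℕ), rowOf a x.2]

/-- Column index of a strip cell (`0` off the strip). [folklore] -/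
def fin3 (i : ℤ) (v : Site 2) : Fin 3 := if h : 0 ≤ v 0 - i ∧ v 0 - i ≤ 2 then ⟨(v 0 - i).toNat, by omega⟩ else 0

/-- Strip cell ↦ cylinder cell. [folklore] -/
def σ (i a : ℤ) (N : ℕ) (v : Site 2) : Fin 3 × ZMod N := (fin3 i v, zOf a N (v 1))

/-- Coordinates of `ψ`. [folklore] -/
theorem ψ_apply (i a : ℤ) {N : ℕ} (x : Fin 3 × ZMod N) : ψ i a x 0 = i + (x.1 : ℕ) ∧ ψ i a x 1 = rowOf a x.2 :=
  ⟨rfl, rfl⟩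

/-- `ψ ∘ σ = id` on the strip window. [folklore] -/
theorem ψ_σ (i a : ℤ) {N : ℕ} [NeZero N] (v : Site 2) (h0 : i ≤ v 0) (h0' : v 0 ≤ i + 2) (h1 : a ≤ v 1)
    (h1' : v 1 < a + N) : ψ i a (σ i a N v) = v := by
  rw [site2_eq_iff, (ψ_apply i a _).1, (ψ_apply i a _).2]
  simp only [σ, fin3, dif_pos (show 0 ≤ v 0 - i ∧ v 0 - i ≤ 2 by omega), rowOf_zOf a h1 h1', and_true]
  rw [Int.toNat_of_nonneg (by omega)]; ring

/-- `σ ∘ ψ = id`. [folklore] -/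
theorem σ_ψ (i a : ℤ) {N : ℕ} [NeZero N] (x : Fin 3 × ZMod N) : σ i a N (ψ i a x) = x := by
  have hx : ((x.1 : ℕ) : ℤ) ≤ 2 := by have := x.1.2; omega
  refine Prod.ext ?_ ?_
  · simp only [σ, fin3, (ψ_apply i a x).1, dif_pos (show 0 ≤ i + (x.1 : ℕ) - i ∧ i + (x.1 : ℕ) - i ≤ 2 by omega)]
    exact Fin.ext (by simp)
  · simp only [σ, (ψ_apply i a x).2, zOf_rowOf]

/-- Colours: the cylinder colouring read off the strip is the strip colour of `ψ`. [folklore] -/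
theorem mem_X_ψ (i a : ℤ) {N : ℕ} (τ κ₀ κ₂ : Bool) (b : K) (x : Fin 3 × ZMod N) :
    ψ i a x ∈ (X i τ κ₀ κ₂ b).1 ↔ (cylMap a N τ κ₀ κ₂ b).1 x = true := by
  simp only [X, Set.mem_setOf_eq, (ψ_apply i a x).1, (ψ_apply i a x).2, cylMap]
  constructor
  · rintro ⟨j, hj, h⟩
    have : j = x.1 := Fin.ext (by omega)
    rwa [this] at h
  · intro h; exact ⟨x.1, rfl, h⟩

/-- Colours of strip cells. [folklore] -/
theorem mem_X_iff (i : ℤ) (τ κ₀ κ₂ : Bool) (b : K) (v : Site 2) (j : Fin 3) (hv : v 0 = i + (j : ℕ)) :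
    v ∈ (X i τ κ₀ κ₂ b).1 ↔ col τ κ₀ κ₂ b j (v 1) = true := by
  simp only [X, Set.mem_setOf_eq]
  constructor
  · rintro ⟨j', hj', h⟩
    have : j' = j := Fin.ext (by omega)
    rwa [this] at h
  · intro h; exact ⟨j, hv, h⟩

/-- Flags of strip faces. [folklore] -/
theorem mem_X2_iff (i : ℤ) (τ κ₀ κ₂ : Bool) (b : K) (f : Site 2) (j : Fin 2) (hf : f 0 = i + (j : ℕ)) :
    f ∈ (X i τ κ₀ κ₂ b).2 ↔ flag τ b j (f 1) = true := by
  simp only [X, Set.mem_setOf_eq]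
  constructor
  · intro h; exact h j hf
  · intro h j' hj'
    have : j' = j := Fin.ext (by omega)
    rwa [this]

/-- LOCAL ISOMORPHISM: at an interior row, the cylinder block read off the strip has the edges of the strip. [folklore] -/
theorem block_adj_iff_cell (i a : ℤ) {N : ℕ} [NeZero N] (τ κ₀ κ₂ : Bool) (b : K) (x y : Fin 3 × ZMod N)
    (hx : a + 1 ≤ rowOf a x.2) (hx' : rowOf a x.2 + 1 < a + N) :
    (blockGraph N (cylMap a N τ κ₀ κ₂ b).2).Adj x y ↔ (cellGraph (X i τ κ₀ κ₂ b).2).Adj (ψ i a x) (ψ i a y) := by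
  rw [blockGraph_adj_iff a _ x y hx hx', cellGraph_adj_iff, (ψ_apply i a x).1, (ψ_apply i a x).2,
    (ψ_apply i a y).1, (ψ_apply i a y).2,
    show (i + ((x.1 : ℕ) : ℤ), rowOf a x.2) = (((x.1 : ℕ) : ℤ) + i, rowOf a x.2 + 0) by rw [add_comm, add_zero],
    show (i + ((y.1 : ℕ) : ℤ), rowOf a y.2) = (((y.1 : ℕ) : ℤ) + i, rowOf a y.2 + 0) by rw [add_comm, add_zero]]
  refine grid_adj_map _ _ i 0 (_, _) (_, _) fun c d hc hd => ?_
  simp only at hc hd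
  have hcc : 0 ≤ c ∧ c ≤ 1 := by
    have := x.1.2; have := y.1.2; omega
  have hdd : a ≤ d ∧ d < a + N := by
    have := rowOf_mem a x.2; have := rowOf_mem a y.2; omega
  rw [add_zero, mem_X2_iff i τ κ₀ κ₂ b _ ⟨c.toNat, by omega⟩ (by simp; omega)]
  simp only [cylMap, Matrix.cons_val_one, Matrix.cons_val_zero, rowOf_zOf a hdd.1 hdd.2]
  constructor
  · rintro ⟨j, hj, h⟩
    have : j = ⟨c.toNat, by omega⟩ := Fin.ext (by simp; omega)
    rwa [this] at h
  · intro h; exact ⟨⟨c.toNat, by omega⟩, by simp; omega, h⟩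

/-- Restricting a path to an invariant predicate of its start. [folklore] -/
theorem within_restrict {V : Type*} (H : SimpleGraph V) (W : Set V) (Pr : V → Prop)
    (hP : ∀ u v, H.Adj u v → (Pr u ↔ Pr v)) {x y : V} (hxW : x ∈ W) (hx : Pr x) (h : (within H W).Reachable x y) :
    (within H (W ∩ {z | Pr z})).Reachable x y := by
  rw [SimpleGraph.reachable_iff_reflTransGen] at h
  induction h with
  | refl => exact SimpleGraph.Reachable.refl _
  | @tail b' c _ hbc ih =>
    have hb : Pr b' := (within_reachable_mem _ _ ih (show x ∈ W ∩ {z | Pr z} from ⟨hxW, hx⟩)).2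
    exact ih.trans (SimpleGraph.Adj.reachable ⟨hbc.1, ⟨hbc.2.1, hb⟩, hbc.2.2, (hP _ _ hbc.1).1 hb⟩)

/-! ## §11 Strip clusters, window diagrams, and the transfer of connections -/

/-- The colour class of `p` inside the strip. [folklore] -/
def cls (x : Obs) (i : ℤ) (p : Site 2) : Set (Site 2) := {v | (v ∈ x.1 ↔ p ∈ x.1) ∧ i ≤ v 0 ∧ v 0 ≤ i + 2}

/-- The colour class of `p` inside the strip window of rows `[lo, hi]`. [folklore] -/
def clsW (x : Obs) (i lo hi : ℤ) (p : Site 2) : Set (Site 2) := cls x i p ∩ {v | lo ≤ v 1 ∧ v 1 ≤ hi}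

/-- The strip diagram through `within`-reachability. [folklore] -/
theorem mem_stripDiagram_iff (i : ℤ) (x : Obs) (p q : Site 2) :
    (p, q) ∈ stripDiagram i x ↔ (p 0 = i ∨ p 0 = i + 2) ∧ (q 0 = i ∨ q 0 = i + 2) ∧ q ∈ cls x i p ∧ p ∈ cls x i p ∧
      (within (cellGraph x.2) (cls x i p)).Reachable p q := by
  simp only [stripDiagram, Set.mem_setOf_eq]
  constructor
  · rintro ⟨h1, h2, h, h1', hr⟩
    exact ⟨h1, h2, h, ⟨Iff.rfl, h1'⟩, (induce_reachable_iff _ _ _ _).1 hr⟩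
  · rintro ⟨h1, h2, h, hp, hr⟩
    exact ⟨h1, h2, h, hp.2, (induce_reachable_iff (cellGraph x.2) (cls x i p) (u := p) ⟨Iff.rfl, hp.2⟩ h).2 hr⟩

/-- The WINDOW DIAGRAM: boundary pairs joined by a monochromatic strip path inside the rows `[lo, hi]`. [folklore] -/
def DgW (i lo hi : ℤ) (x : Obs) : Set (Site 2 × Site 2) :=
  {pq | (pq.1 0 = i ∨ pq.1 0 = i + 2) ∧ (pq.2 0 = i ∨ pq.2 0 = i + 2) ∧ pq.2 ∈ clsW x i lo hi pq.1 ∧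
    pq.1 ∈ clsW x i lo hi pq.1 ∧ (within (cellGraph x.2) (clsW x i lo hi pq.1)).Reachable pq.1 pq.2}

/-- Window diagrams grow with the window. [folklore] -/
theorem DgW_mono {i lo hi lo' hi' : ℤ} (h1 : lo' ≤ lo) (h2 : hi ≤ hi') (x : Obs) : DgW i lo hi x ⊆ DgW i lo' hi' x := by
  have hsub : ∀ p, clsW x i lo hi p ⊆ clsW x i lo' hi' p := fun p v hv =>
    ⟨hv.1, by have := hv.2.1; omega, by have := hv.2.2; omega⟩
  rintro ⟨p, q⟩ ⟨hp, hq, hq', hp', hr⟩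
  exact ⟨hp, hq, hsub p hq', hsub p hp', within_mono _ (hsub p) hr⟩

/-- Window diagrams are parts of the strip diagram. [folklore] -/
theorem DgW_subset (i lo hi : ℤ) (x : Obs) : DgW i lo hi x ⊆ stripDiagram i x := by
  rintro ⟨p, q⟩ ⟨hp, hq, hq', hp', hr⟩
  rw [mem_stripDiagram_iff]
  exact ⟨hp, hq, hq'.1, hp'.1, within_mono _ Set.inter_subset_left hr⟩

/-- Every strip connection happens inside some finite window. [folklore] -/
theorem exists_DgW (i : ℤ) (x : Obs) {p q : Site 2} (h : (p, q) ∈ stripDiagram i x) : ∃ m : ℕ, (p, q) ∈ DgW i (-m) m x := by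
  rw [mem_stripDiagram_iff] at h
  obtain ⟨hp, hq, hq', hp', hr⟩ := h
  have key : ∀ {v : Site 2}, Relation.ReflTransGen (within (cellGraph x.2) (cls x i p)).Adj p v →
      ∃ m : ℕ, (p 1).natAbs ≤ m ∧ (v 1).natAbs ≤ m ∧
        (within (cellGraph x.2) (cls x i p ∩ {w | -(m : ℤ) ≤ w 1 ∧ w 1 ≤ m})).Reachable p v := by
    intro v h
    induction h with
    | refl => exact ⟨(p 1).natAbs, le_rfl, le_rfl, SimpleGraph.Reachable.refl _⟩
    | @tail b' c _ hbc ih =>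
      obtain ⟨m, h1, h2, h3⟩ := ih
      refine ⟨max m (c 1).natAbs, by omega, by omega, ?_⟩
      have hsub : cls x i p ∩ {w : Site 2 | -(m : ℤ) ≤ w 1 ∧ w 1 ≤ m} ⊆
          cls x i p ∩ {w : Site 2 | -((max m (c 1).natAbs : ℕ) : ℤ) ≤ w 1 ∧ w 1 ≤ (max m (c 1).natAbs : ℕ)} :=
        fun w hw => ⟨hw.1, by have := hw.2.1; omega, by have := hw.2.2; omega⟩
      have hb' : b' ∈ cls x i p ∩ {w : Site 2 | -((max m (c 1).natAbs : ℕ) : ℤ) ≤ w 1 ∧ w 1 ≤ (max m (c 1).natAbs : ℕ)} :=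
        ⟨hbc.2.1, by show _ ∧ _; omega⟩
      have hc' : c ∈ cls x i p ∩ {w : Site 2 | -((max m (c 1).natAbs : ℕ) : ℤ) ≤ w 1 ∧ w 1 ≤ (max m (c 1).natAbs : ℕ)} :=
        ⟨hbc.2.2, by show _ ∧ _; omega⟩
      exact (within_mono _ hsub h3).trans (SimpleGraph.Adj.reachable ⟨hbc.1, hb', hc'⟩)
  obtain ⟨m, h1, h2, h3⟩ := key ((SimpleGraph.reachable_iff_reflTransGen _ _).1 hr)
  have hq1 : -(m : ℤ) ≤ q 1 ∧ q 1 ≤ m := by omega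
  have hp1 : -(m : ℤ) ≤ p 1 ∧ p 1 ≤ m := by omega
  exact ⟨m, hp, hq, ⟨hq', hq1⟩, ⟨hp', hp1⟩, h3⟩

/-- STRIP TO CYLINDER: a monochromatic strip path inside interior rows is a monochromatic path of the cylinder block. [folklore] -/
theorem reach_cyl_of_strip (i a : ℤ) {N : ℕ} [NeZero N] (τ κ₀ κ₂ : Bool) (b : K) {lo hi : ℤ} (hlo : a + 1 ≤ lo)
    (hhi : hi + 1 < a + N) {p q : Site 2}
    (h : (within (cellGraph (X i τ κ₀ κ₂ b).2) (clsW (X i τ κ₀ κ₂ b) i lo hi p)).Reachable p q) :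
    (blockGraph N (cylMap a N τ κ₀ κ₂ b).2 ⊓ monoGraph (cylMap a N τ κ₀ κ₂ b).1).Reachable (σ i a N p) (σ i a N q) := by
  have hψ : ∀ u ∈ clsW (X i τ κ₀ κ₂ b) i lo hi p, ψ i a (σ i a N u) = u := fun u hu =>
    ψ_σ i a u hu.1.2.1 hu.1.2.2 (by have := hu.2.1; omega) (by have := hu.2.2; omega)
  have hc : ∀ u ∈ clsW (X i τ κ₀ κ₂ b) i lo hi p, ((cylMap a N τ κ₀ κ₂ b).1 (σ i a N u) = true ↔ p ∈ (X i τ κ₀ κ₂ b).1) :=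
    fun u hu => by rw [← mem_X_ψ i a, hψ u hu]; exact hu.1.1
  let φ : within (cellGraph (X i τ κ₀ κ₂ b).2) (clsW (X i τ κ₀ κ₂ b) i lo hi p) →g
      blockGraph N (cylMap a N τ κ₀ κ₂ b).2 ⊓ monoGraph (cylMap a N τ κ₀ κ₂ b).1 :=
    { toFun := σ i a N
      map_rel' := fun {u v} huv => by
        obtain ⟨hadj, hu, hv⟩ := huv
        have hrow : rowOf a (σ i a N u).2 = u 1 := by
          simp only [σ]; exact rowOf_zOf a (by have := hu.2.1; omega) (by have := hu.2.2; omega)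
        have hB : (blockGraph N (cylMap a N τ κ₀ κ₂ b).2).Adj (σ i a N u) (σ i a N v) := by
          rw [block_adj_iff_cell i a τ κ₀ κ₂ b _ _ (by rw [hrow]; have := hu.2.1; omega)
            (by rw [hrow]; have := hu.2.2; omega), hψ u hu, hψ v hv]
          exact hadj
        refine ⟨hB, hB.ne, ?_⟩
        rw [Bool.eq_iff_iff, hc u hu, hc v hv] }
  exact h.map φ

/-- CYLINDER TO STRIP: a monochromatic path of the cylinder block inside interior rows is a monochromatic strip path. [folklore] -/
theorem reach_strip_of_cyl (i a : ℤ) {N : ℕ} [NeZero N] (τ κ₀ κ₂ : Bool) (b : K) {lo hi : ℤ} (hlo : a + 1 ≤ lo)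
    (hhi : hi + 1 < a + N) {x y : Fin 3 × ZMod N} (hxr : lo ≤ rowOf a x.2 ∧ rowOf a x.2 ≤ hi)
    (h : (within (blockGraph N (cylMap a N τ κ₀ κ₂ b).2 ⊓ monoGraph (cylMap a N τ κ₀ κ₂ b).1)
      {z | lo ≤ rowOf a z.2 ∧ rowOf a z.2 ≤ hi}).Reachable x y) :
    (within (cellGraph (X i τ κ₀ κ₂ b).2) (clsW (X i τ κ₀ κ₂ b) i lo hi (ψ i a x))).Reachable (ψ i a x) (ψ i a y) := by
  set c := (cylMap a N τ κ₀ κ₂ b).1 with hcdef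
  have h' := within_restrict _ {z : Fin 3 × ZMod N | lo ≤ rowOf a z.2 ∧ rowOf a z.2 ≤ hi} (fun z => c z = c x)
    (fun u v huv => by rw [(SimpleGraph.inf_adj _ _ _ _).1 huv |>.2.2]) hxr rfl h
  let φ : within (blockGraph N (cylMap a N τ κ₀ κ₂ b).2 ⊓ monoGraph c)
      ({z : Fin 3 × ZMod N | lo ≤ rowOf a z.2 ∧ rowOf a z.2 ≤ hi} ∩ {z | c z = c x}) →g
      within (cellGraph (X i τ κ₀ κ₂ b).2) (clsW (X i τ κ₀ κ₂ b) i lo hi (ψ i a x)) :=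
    { toFun := ψ i a
      map_rel' := fun {u v} huv => by
        obtain ⟨⟨hadj, -, -⟩, ⟨hu, hcu⟩, ⟨hv, hcv⟩⟩ := huv
        have hmem : ∀ w : Fin 3 × ZMod N, lo ≤ rowOf a w.2 ∧ rowOf a w.2 ≤ hi → c w = c x →
            ψ i a w ∈ clsW (X i τ κ₀ κ₂ b) i lo hi (ψ i a x) := fun w hw hcw =>
          ⟨⟨by rw [mem_X_ψ, mem_X_ψ, ← hcdef, hcw], by rw [(ψ_apply i a w).1]; omega,
            by rw [(ψ_apply i a w).1]; have := w.1.2; omega⟩,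
           by rw [(ψ_apply i a w).2]; exact hw.1, by rw [(ψ_apply i a w).2]; exact hw.2⟩
        exact ⟨(block_adj_iff_cell i a τ κ₀ κ₂ b u v (by have := hu.1; omega) (by have := hu.2; omega)).1 hadj,
          hmem u hu hcu, hmem v hv hcv⟩ }
  exact h'.map φ

/-- EXIT ROWS: an edge of the block leaving the interior rows `[lo, hi]` starts at row `lo` or `hi`. [folklore] -/
theorem exit_row (a : ℤ) {N : ℕ} [NeZero N] (τ κ₀ κ₂ : Bool) (b : K) {lo hi : ℤ} (hlo : a + 1 ≤ lo)
    (hhi : hi + 1 < a + N) {w w' : Fin 3 × ZMod N} (hw : lo ≤ rowOf a w.2 ∧ rowOf a w.2 ≤ hi)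
    (hw' : ¬ (lo ≤ rowOf a w'.2 ∧ rowOf a w'.2 ≤ hi)) (hadj : (blockGraph N (cylMap a N τ κ₀ κ₂ b).2).Adj w w') :
    rowOf a w.2 = lo ∨ rowOf a w.2 = hi := by
  have hnear := grid_adj_near _ ((blockGraph_adj_iff a _ w w' (by omega) (by omega)).1 hadj)
  simp only at hnear
  omega

/-- THE DICHOTOMY: a monochromatic cylinder connection between cells of the window either is a monochromatic strip
connection inside the window, or exhibits a monochromatic strip path from the start to an extreme row of the window. [folklore] -/
theorem strip_dichotomy (i a : ℤ) {N : ℕ} [NeZero N] (τ κ₀ κ₂ : Bool) (b : K) {lo hi : ℤ} (hlo : a + 1 ≤ lo)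
    (hhi : hi + 1 < a + N) {p q : Site 2} (hp0 : i ≤ p 0 ∧ p 0 ≤ i + 2) (hp1 : lo ≤ p 1 ∧ p 1 ≤ hi)
    (hq0 : i ≤ q 0 ∧ q 0 ≤ i + 2) (hq1 : lo ≤ q 1 ∧ q 1 ≤ hi)
    (h : (blockGraph N (cylMap a N τ κ₀ κ₂ b).2 ⊓ monoGraph (cylMap a N τ κ₀ κ₂ b).1).Reachable (σ i a N p) (σ i a N q)) :
    (within (cellGraph (X i τ κ₀ κ₂ b).2) (clsW (X i τ κ₀ κ₂ b) i lo hi p)).Reachable p q ∨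
      ∃ w : Site 2, (w 1 = lo ∨ w 1 = hi) ∧
        (within (cellGraph (X i τ κ₀ κ₂ b).2) (clsW (X i τ κ₀ κ₂ b) i lo hi p)).Reachable p w := by
  have hpσ : ψ i a (σ i a N p) = p := ψ_σ i a p hp0.1 hp0.2 (by omega) (by omega)
  have hqσ : ψ i a (σ i a N q) = q := ψ_σ i a q hq0.1 hq0.2 (by omega) (by omega)
  have hrp : rowOf a (σ i a N p).2 = p 1 := by simp only [σ]; exact rowOf_zOf a (by omega) (by omega)
  rcases exists_exit _ {z : Fin 3 × ZMod N | lo ≤ rowOf a z.2 ∧ rowOf a z.2 ≤ hi} (u := σ i a N p)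
    (by simp only [Set.mem_setOf_eq, hrp]; exact hp1) h with hr | ⟨w, w', hw, hw', hadj, hr⟩
  · left
    have := reach_strip_of_cyl i a τ κ₀ κ₂ b hlo hhi (by rw [hrp]; exact hp1) hr
    rwa [hpσ, hqσ] at this
  · right
    refine ⟨ψ i a w, ?_, ?_⟩
    · rw [(ψ_apply i a w).2]
      exact exit_row a τ κ₀ κ₂ b hlo hhi hw hw' ((SimpleGraph.inf_adj _ _ _ _).1 hadj).1
    · have := reach_strip_of_cyl i a τ κ₀ κ₂ b hlo hhi (by rw [hrp]; exact hp1) hr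
      rwa [hpσ] at this


end SDE

/-- THE DICHOTOMY (part 4 of `stub_StripDiagramExchange`). [folklore] -/
theorem stripDX_dichotomy : ∀ (i a : ℤ) (N : ℕ) [NeZero N] (τ κ₀ κ₂ : Bool) (b : SDE.K) (lo hi : ℤ), a + 1 ≤ lo → hi + 1 < a + N → ∀ (p q : Site 2), (i ≤ p 0 ∧ p 0 ≤ i + 2) → (lo ≤ p 1 ∧ p 1 ≤ hi) → (i ≤ q 0 ∧ q 0 ≤ i + 2) → (lo ≤ q 1 ∧ q 1 ≤ hi) → (blockGraph N (SDE.cylMap a N τ κ₀ κ₂ b).2 ⊓ monoGraph (SDE.cylMap a N τ κ₀ κ₂ b).1).Reachable (SDE.σ i a N p) (SDE.σ i a N q) → (SDE.within (cellGraph (SDE.X i τ κ₀ κ₂ b).2) (SDE.clsW (SDE.X i τ κ₀ κ₂ b) i lo hi p)).Reachable p q ∨ ∃ w : Site 2, (w 1 = lo ∨ w 1 = hi) ∧ (SDE.within (cellGraph (SDE.X i τ κ₀ κ₂ b).2) (SDE.clsW (SDE.X i τ κ₀ κ₂ b) i lo hi p)).Reachable p w :=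
  fun i a _ _ τ κ₀ κ₂ b _ _ hlo hhi _ _ hp0 hp1 hq0 hq1 h => SDE.strip_dichotomy i a τ κ₀ κ₂ b hlo hhi hp0 hp1 hq0 hq1 h

end Summit.CriticalPhenomena.CardyFormulaZ2.Theorems.IKLinearTransport.PinnedDiagramExchange
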